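import Summits.QuantumFields.YangMills.Theorems.BalabanUVNodesK1V10Defs
import Literature.MathematicalPhysics.QuantumFieldTheory.Balaban1983to89.Node00.CarriersB8Per

/-! DEF-1 g9 — BY-NAME REVIEW of DOOR (c) (plan g86 PENS-217 (P2)(c); dag-n05-w1 g3 P2 (B) `Node00/CarriersB8Per.lean` p638649: `upOfRecord₅CS_b8_iff_of_res_X_eq` ∕ `upOfRecord₅CS_pinB8Per_b8_iff`)
AGAINST THE REGISTERED RUNG BYTES as read by `K1V9Defs.RecordSV` (p628520; `K1V10Defs` p634834 keeps `RecordSV`): at an `RecordSⱽ` world the S-binding clause is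
`∀ P, w.up P = Node00.upOfRecord₅CS F 2 (θ'.toStage5₁₃CoPH F 2) P` for the PRESENTING tuple `θ'`, and `(θ'.toStage5₁₃CoPH F 2).res.X` IS `θ'.res.X` (free residual data), so a
presenting tuple whose residual [B8] group is the periodic substitution meets `B8LeafOfRecordPer` through door (c₂) — no rung re-key.  Scratch; not filed. -/

noncomputable section

open scoped Matrix.Norms.L2Operator

namespace Summit.QuantumFields.YangMills.Cruxes.DEF1DoorCReview

open Literature.MathematicalPhysics.QuantumFieldTheory.Balaban1983to89
open Literature.MathematicalPhysics.QuantumFieldTheory.Balaban1983to89.T4Continuum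
open Literature.MathematicalPhysics.QuantumFieldTheory.Balaban1983to89.DagBinding
open Summit.QuantumFields.YangMills.Theorems.K1V9Defs

/-- the Stage-13 view's residual `X` group IS the tuple's (free data), `rfl` -/
example {F : T4Family} (θ' : Node00.Stage13HParams F 2) (R : B12.RunParams) : (θ'.toStage5₁₃CoPH F 2).res.X R = θ'.res.X R := rfl

/-- DOOR (c₂) read at an `RecordSⱽ` world's S-binding clause: the world's [B8] leaf IS `B8LeafOfRecordPer` for a presenting tuple with the periodic residual substitution. -/
theorem world_b8_iff_b8LeafOfRecordPer {F : T4Family} (θ' : Node00.Stage13HParams F 2) (w : WorldP) (R : B12.RunParams)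
    (hup : w.up R = Node00.upOfRecord₅CS F 2 (θ'.toStage5₁₃CoPH F 2) R)
    (X₀ : PrintedCarriersR) (P : ℕ) (lam : Node00.ResidB8Per (θ'.toStage5₁₃CoPH F 2).toStage3Params P)
    (hX : θ'.res.X R = X₀.withB8OfRecordPer (θ'.toStage5₁₃CoPH F 2).toStage3Params P lam) :
    (w.up R).b8 ↔ Node00.B8LeafOfRecordPer (θ'.toStage5₁₃CoPH F 2).toStage3Params P lam := by
  rw [hup]
  exact Node00.upOfRecord₅CS_b8_iff_of_res_X_eq F 2 (θ'.toStage5₁₃CoPH F 2) R X₀ P lam hX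

/-- … and from `RecordSV F θ h v w` itself: the presenting tuple `θ'` with its S-binding clause, read off the def (nothing else of the class used). -/
theorem exists_presenting_up_of_recordSV {F : T4Family} {θ : Node00.Stage13HParams F 2} {h : θ.Provisos₁₃SepCoPH F 2} {v : Node00.Revision₁₃ F 2 θ h} {w : WorldP}
    (hR : RecordSV F θ h v w) :
    ∃ (θ' : Node00.Stage13HParams F 2) (_h' : θ'.Provisos₁₃SepCoPH F 2), θ'.Admissible F 2 ∧
      Node00.datumOfRecord₁₃SepCoPH F 2 θ h = Node00.datumOfRecord₁₃SepCoPH F 2 θ' _h' ∧ ∀ P : B12.RunParams, w.up P = Node00.upOfRecord₅CS F 2 (θ'.toStage5₁₃CoPH F 2) P := by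
  obtain ⟨θ', h', hθ', hD, -, -, -, hup⟩ := hR
  exact ⟨θ', h', hθ', hD, hup⟩

/-- THE REVIEWED STATEMENT: at an `RecordSⱽ` world whose presenting tuple carries the periodic [B8] substitution on run `R`, the world's `b8` leaf ↔ `B8LeafOfRecordPer …`. -/
theorem recordSV_b8_iff_b8LeafOfRecordPer {F : T4Family} {θ : Node00.Stage13HParams F 2} {h : θ.Provisos₁₃SepCoPH F 2} {v : Node00.Revision₁₃ F 2 θ h} {w : WorldP}
    (θ' : Node00.Stage13HParams F 2) (h' : θ'.Provisos₁₃SepCoPH F 2) (hθ' : θ'.Admissible F 2)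
    (hD : Node00.datumOfRecord₁₃SepCoPH F 2 θ h = Node00.datumOfRecord₁₃SepCoPH F 2 θ' h') (hC : w.C = (Node00.datumOfRecord₁₃SepCoPHV F 2 θ h v).C)
    (hγ : 0 < w.γ ∧ w.γ ≤ θ'.γ) (hL : w.L = (θ'.L : ℝ)) (hup : ∀ P : B12.RunParams, w.up P = Node00.upOfRecord₅CS F 2 (θ'.toStage5₁₃CoPH F 2) P)
    (R : B12.RunParams) (X₀ : PrintedCarriersR) (P : ℕ) (lam : Node00.ResidB8Per (θ'.toStage5₁₃CoPH F 2).toStage3Params P)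
    (hX : θ'.res.X R = X₀.withB8OfRecordPer (θ'.toStage5₁₃CoPH F 2).toStage3Params P lam) :
    RecordSV F θ h v w ∧ ((w.up R).b8 ↔ Node00.B8LeafOfRecordPer (θ'.toStage5₁₃CoPH F 2).toStage3Params P lam) :=
  ⟨⟨θ', h', hθ', hD, hC, hγ, hL, hup⟩, world_b8_iff_b8LeafOfRecordPer θ' w R (hup R) X₀ P lam hX⟩

end Summit.QuantumFields.YangMills.Cruxes.DEF1DoorCReview

end
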